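import Mathlib
import HarnessLib
import Literature.AlgebraicGeometry.Resolution.BlowupFibreConeModel
import Literature.AlgebraicGeometry.Resolution.AffineDomainEquidim
import Literature.AlgebraicGeometry.Resolution.BlowupAxialPoint
import Summits.ResolutionOfSingularities.ResolutionOfSingularities.Theorems.WildQuotientsWildQuotientResolutionKSBlowupFixedPointRegular

/-!
# Kollár–Szabó going down, blow-up step (K2-scheme, dimension): a quadratic transform with the same residue
# field has the same dimension; the fixed point of the point blow-up is a CLOSED point
# (crux `WildQuotients.WildQuotientResolution`, stub `stub_phaseZeroHighDim`)

Crux stmt-ResolutionOfSingularities-15640 (`WildQuotientResolution`), registered stub `stub_phaseZeroHighDim`;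
programme PHASE0-KS-EIGENLINE, completion of hand 8-g2's chain (✓`exists_regular_fixedPoint_liftAction`, p829239):

* `MvPolynomial.height_eq_card_of_isMaximal` — maximal ideals of `k[x_σ]` (`σ` finite) have height `|σ|`
  (✓`MvPolynomial.height_eq_of_isMaximal` transported along `renameEquiv`);
* `isMaximal_comap_of_residue` — for a quadratic transform `R ⊇ S[𝔪/x] ⊇ S` with the SAME residue field as `S`
  (every `r ∈ R` congruent to some `s ∈ S`), the contraction `𝔫 = 𝔪_R ∩ S[𝔪/x]` is MAXIMAL;
* `ringKrullDim_eq_of_isQuadraticTransform_of_residue` — **such a quadratic transform of a regular local `S` has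
  `dim R = dim S`**: `R = S[𝔪/x]_𝔫`, `dim R = dim R/(x) + 1` (Mathlib, `x` a non-zero-divisor in `𝔪_R`),
  `R/(x) = (S[𝔪/x]/(x))_𝔫̄` (✓`isLocalization_atPrime_quotient_mapExt_of_le`) with `S[𝔪/x]/(x) ≅ κ(S)[T₁,…,T_{d−1}]`
  (✓`blowupRing_chartQuotient_of_not_mem_sq`), so `dim R/(x) = ht 𝔫̄ = d − 1`;
* `exists_closed_regular_fixedPoint_liftAction` — **the Kollár–Szabó fixed point `x'` of the point blow-up is a
  CLOSED point with `dim 𝒪_{X',x'} = dim 𝒪_{X,x}`**, regular, with algebraically closed residue field, in the inertia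
  of every `g` (✓`IsBlowup.isClosed_singleton_of_ringKrullDim_eq`): ALL hypotheses of the step reproduce.

[OURS · crux stmt-ResolutionOfSingularities-15640 · helper toward `stub_phaseZeroHighDim` (dimension/closedness
of the fixed point of the abstract blow-up step of Kollár–Szabó going down; NOT a proof of the stub); folklore,
counted 0; AI-level work, weaker than expert review.] [folklore]
-/

-- single-problem summit: the doubled namespace component `ResolutionOfSingularities` is forced
set_option linter.dupNamespace false

noncomputable section

open CategoryTheory CategoryTheory.Limits AlgebraicGeometry TopologicalSpace IsLocalRing
open Literature.AlgebraicGeometry.Ramification Literature.AlgebraicGeometry.Resolution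
open Scheme.IdealSheafData
open Summit.ResolutionOfSingularities.ResolutionOfSingularities.Theorems.WildQuotientResolution

namespace Summit.ResolutionOfSingularities.ResolutionOfSingularities.Theorems.WildQuotientResolution.KSGoingDown

universe u

/-! ## Heights of maximal ideals of polynomial rings -/

/-- Maximal ideals of a polynomial ring in finitely many variables over a field have height the number of
variables (✓`MvPolynomial.height_eq_of_isMaximal`, transported along `renameEquiv`).
[cite: Matsumura1987, §5 Ex. 5.1] -/
theorem MvPolynomial.height_eq_card_of_isMaximal (k : Type u) [Field k] {σ : Type} [Fintype σ]
    [DecidableEq σ] (M : Ideal (MvPolynomial σ k)) [hM : M.IsMaximal] : M.height = Fintype.card σ := by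
  let e : MvPolynomial (Fin (Fintype.card σ)) k ≃+* MvPolynomial σ k :=
    (MvPolynomial.renameEquiv k (Fintype.equivFin σ).symm).toRingEquiv
  haveI : (M.comap e).IsMaximal := Ideal.comap_isMaximal_of_surjective _ e.surjective
  rw [← RingEquiv.height_comap e M]
  exact MvPolynomial.height_eq_of_isMaximal k _ _

/-! ## Quadratic transforms with the same residue field have the same dimension -/

section Algebra

variable {K : Type u} [Field K]

/-- The contraction of the maximal ideal of a local `R` to a subring `B ⊆ R` is MAXIMAL as soon as every element
of `R` is congruent modulo `𝔪_R` to an element of a further subring `S ⊆ B` (same residue field): an element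
`b ∉ 𝔫` is a unit of `R`, its inverse is `≡ s ∈ S`, so `b s ≡ 1 (mod 𝔫)`. [folklore] -/
theorem isMaximal_comap_of_residue {S B R : Subring K} [IsLocalRing R] (hSB : S ≤ B) (hBR : B ≤ R)
    (hres : ∀ r : R, ∃ s : S, r - Subring.inclusion (hSB.trans hBR) s ∈ maximalIdeal R) :
    ((maximalIdeal R).comap (Subring.inclusion hBR)).IsMaximal := by
  rw [Ideal.isMaximal_iff]
  constructor
  · rw [Ideal.mem_comap, map_one]
    exact (maximalIdeal.isMaximal R).ne_top ∘ (Ideal.eq_top_iff_one _).mpr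
  · intro J b hJ hb hbJ
    rw [Ideal.mem_comap] at hb
    have hbu : IsUnit (Subring.inclusion hBR b) := by
      by_contra h
      exact hb ((IsLocalRing.mem_maximalIdeal _).mpr h)
    obtain ⟨c, hc⟩ := hbu.exists_right_inv
    obtain ⟨s, hs⟩ := hres c
    -- `b s - 1 ∈ 𝔫 ⊆ J`
    have hmem : b * Subring.inclusion hSB s - 1 ∈ (maximalIdeal R).comap (Subring.inclusion hBR) := by
      rw [Ideal.mem_comap, map_sub, map_mul, map_one]
      have e : Subring.inclusion hBR b * Subring.inclusion hBR (Subring.inclusion hSB s) - 1 =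
          -(Subring.inclusion hBR b * (c - Subring.inclusion (hSB.trans hBR) s)) := by
        rw [mul_sub, hc]
        have : Subring.inclusion hBR (Subring.inclusion hSB s) = Subring.inclusion (hSB.trans hBR) s :=
          Subtype.ext rfl
        rw [this]
        ring
      rw [e]
      exact neg_mem (Ideal.mul_mem_left _ _ hs)
    have h1 : b * Subring.inclusion hSB s ∈ J := J.mul_mem_right _ hbJ
    have h2 := J.sub_mem h1 (hJ hmem)
    rwa [sub_sub_cancel] at h2

/-- **A quadratic transform with the same residue field has the same dimension.** For a regular local subring
`S ⊆ K` and a quadratic transform `R` of `S` (✓`IsQuadraticTransform`) such that every element of `R` is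
congruent to an element of `S` modulo `𝔪_R`: `dim R = dim S`. [cite: Cutkosky2014, §2.1] -/
theorem ringKrullDim_eq_of_isQuadraticTransform_of_residue (S R : Subring K) [IsRegularLocalRing S]
    [IsLocalRing R] (hQT : IsQuadraticTransform S R)
    (hres : ∀ r : R, ∃ s : S, r - Subring.inclusion hQT.dominates.1 s ∈ maximalIdeal R) :
    ringKrullDim R = ringKrullDim S := by
  classical
  obtain ⟨_, x, hx, hx0, _, hBle, -, hdom⟩ := id hQT
  have hx0K : ((x : S) : K) ≠ 0 := fun h => hx0 (Subtype.ext h)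
  have hx2 : x ∉ maximalIdeal S ^ 2 := chart_not_mem_sq_of_isQuadraticTransform hx hx0 hBle hdom
  set d := (maximalIdeal S).spanFinrank with hd
  have hd0 : 0 < d := by
    rw [hd, Nat.pos_iff_ne_zero, Ne, Submodule.spanFinrank_eq_zero_iff_eq_bot (IsNoetherian.noetherian _)]
    intro hbot
    exact hx0 ((Submodule.mem_bot S).mp (hbot ▸ hx))
  -- the chart `B = S[𝔪/x]`, a regular ring, its element `x`, and the prime `𝔫 = 𝔪_R ∩ B`
  set B : Subring K := blowupRing S ((x : S) : K) with hB
  obtain ⟨z, hz, hzi⟩ := exists_rsop_apply_eq (R := S) rfl hx hx2 ⟨0, hd0⟩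
  haveI : IsRegularRing B := by
    have h := isRegularRing_blowupRing S rfl z hz ⟨0, hd0⟩
    rwa [hzi] at h
  let xB : B := ⟨((x : S) : K), le_blowupRing S _ x.2⟩
  let 𝔫 : Ideal B := (maximalIdeal R).comap (Subring.inclusion hBle)
  haveI h𝔫max : 𝔫.IsMaximal :=
    isMaximal_comap_of_residue (le_blowupRing S ((x : S) : K)) hBle hres
  have hxB𝔫 : xB ∈ 𝔫 := by
    change Subring.inclusion hBle xB ∈ maximalIdeal R
    rw [mem_maximalIdeal_iff_inv_not_mem]
    right
    intro hinv
    have hinvS : (((x : S) : K))⁻¹ ∈ S := hdom.2 _ x.2 hinv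
    exact (IsLocalRing.mem_maximalIdeal _).mp hx ((isUnit_subring_iff_inv_mem x).mpr ⟨hx0K, hinvS⟩)
  -- `R = B_𝔫`; work with `T = LocalSubring.ofPrime B 𝔫`
  have hRT : R = (LocalSubring.ofPrime B 𝔫).toSubring := hQT.eq_ofPrime hx hx0 hBle
  set T := (LocalSubring.ofPrime B 𝔫).toSubring with hT
  haveI : IsRegularLocalRing T := isRegularLocalRing_ofPrime B 𝔫
  -- `x` in `T`: a non-zero-divisor in the maximal ideal
  have hxT : algebraMap B T xB ∈ maximalIdeal T :=
    (IsLocalization.AtPrime.to_map_mem_maximal_iff T 𝔫 xB).mpr hxB𝔫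
  have hxT0 : algebraMap B T xB ∈ nonZeroDivisors T := by
    refine mem_nonZeroDivisors_of_ne_zero fun h => hx0K ?_
    exact congrArg (fun t : T => (t : K)) h
  have hdimT := ringKrullDim_quotient_span_singleton_succ_eq_ringKrullDim_of_mem_nonZeroDivisors hxT0 hxT
  -- `T/(x) = (B/(x))_{𝔫̄}`
  have hE𝔫 : Ideal.span {xB} ≤ 𝔫 := by
    rw [Ideal.span_le, Set.singleton_subset_iff]
    exact hxB𝔫
  haveI h𝔫bar : (𝔫.map (Ideal.Quotient.mk (Ideal.span {xB}))).IsPrime := isPrime_map_quotientMk_of_le hE𝔫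
  haveI : IsLocalization.AtPrime (T ⧸ (Ideal.span {xB}).map (algebraMap B T))
      (𝔫.map (Ideal.Quotient.mk (Ideal.span {xB}))) :=
    isLocalization_atPrime_quotient_mapExt_of_le hE𝔫 T
  have hmapE : (Ideal.span {xB}).map (algebraMap B T) = Ideal.span {algebraMap B T xB} := by
    rw [Ideal.map_span, Set.image_singleton]
  have hdimQ : ringKrullDim (T ⧸ Ideal.span {algebraMap B T xB}) =
      (𝔫.map (Ideal.Quotient.mk (Ideal.span {xB}))).height := by
    rw [← hmapE]
    exact IsLocalization.AtPrime.ringKrullDim_eq_height _ _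
  -- `B/(x) ≅ κ(S)[T_j : j ≠ 0]`, and `𝔫̄` is maximal there: height `d - 1`
  obtain ⟨ψ, hψ, -⟩ := blowupRing_chartQuotient_of_not_mem_sq S rfl x.2 (by simpa using hx)
    (by simpa using hx2) hx0K hd0
  let eψ := RingEquiv.ofBijective ψ hψ
  haveI : (𝔫.map (Ideal.Quotient.mk (Ideal.span {xB}))).IsMaximal := by
    rcases Ideal.map_eq_top_or_isMaximal_of_surjective (Ideal.Quotient.mk (Ideal.span {xB}))
      Ideal.Quotient.mk_surjective h𝔫max with h | h
    · exact absurd h h𝔫bar.ne_top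
    · exact h
  haveI : ((𝔫.map (Ideal.Quotient.mk (Ideal.span {xB}))).comap eψ).IsMaximal :=
    Ideal.comap_isMaximal_of_surjective _ eψ.surjective
  have hheight : (𝔫.map (Ideal.Quotient.mk (Ideal.span {xB}))).height = (d - 1 : ℕ) := by
    rw [← RingEquiv.height_comap eψ, MvPolynomial.height_eq_card_of_isMaximal]
    congr 1
    simp [hd]
  -- assemble: `dim T = (d - 1) + 1 = d = dim S`
  have hdimS : ringKrullDim S = (d : ℕ) := by
    rw [← IsRegularLocalRing.spanFinrank_maximalIdeal (R := S)]
  rw [hRT, hdimS, ← hdimT, hdimQ, hheight]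
  have hd1 : d - 1 + 1 = d := Nat.sub_add_cancel hd0
  conv_rhs => rw [← hd1]
  rfl

end Algebra

/-! ## The closed regular fixed point -/

/-- **The Kollár–Szabó fixed point of the point blow-up is a CLOSED regular point of the same dimension.** For an
integral locally Noetherian scheme `X`, an abelian group `G` with `g ∈ I_x` for all `g` at a closed point `x`
whose local ring is regular, not a field, with algebraically closed residue field, and a blowing up `π : X' → X`
along the reduced closed point `{x}` with its lifted action: there is a CLOSED point `x' ∈ X'` over `x` lying in
the inertia group of every `g`, with `𝒪_{X',x'}` regular of dimension `dim 𝒪_{X,x}` and `κ(x')` algebraically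
closed — every hypothesis of the step reproduces, so the fixed point climbs any tower of point blow-ups.
[cite: ReichsteinYoussin2000, Appendix (Kollár–Szabó), proof of Prop. A.2] -/
theorem exists_closed_regular_fixedPoint_liftAction {X : Scheme.{0}} [IsIntegral X] [IsLocallyNoetherian X]
    {G : Type} [CommGroup G] (σ : G →* Aut X) {x : X} (hx : IsClosed ({x} : Set X))
    (hGx : ∀ g, g ∈ inertiaSubgroup σ x)
    [IsRegularLocalRing (X.presheaf.stalk x)] [IsAlgClosed (ResidueField (X.presheaf.stalk x))]
    (hnf : ¬ IsField (X.presheaf.stalk x))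
    {X' : Scheme.{0}} {π : X' ⟶ X} (hπ : IsBlowup π (vanishingIdeal ⟨{x}, hx⟩)) :
    ∃ x' : X', π x' = x ∧ IsClosed ({x'} : Set X') ∧
      (∀ g, g ∈ inertiaSubgroup (hπ.liftAction σ (vanishingIdeal_comap_eq_of_action σ ⟨{x}, hx⟩
        (preimage_singleton_eq_of_forall_mem_inertiaSubgroup σ hGx))) x') ∧
      IsRegularLocalRing (X'.presheaf.stalk x') ∧ IsAlgClosed (ResidueField (X'.presheaf.stalk x')) ∧
      ringKrullDim (X'.presheaf.stalk x') = ringKrullDim (X.presheaf.stalk x) := by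
  haveI : IsIntegral X' :=
    hπ.isIntegral (vanishingIdeal_singleton_ne_bot hx (genericPoint_ne_of_not_isField hnf))
  haveI : IsLocallyNoetherian X' := hπ.isLocallyNoetherian
  obtain ⟨R, hRloc, ι, hιloc, t, φ, x', hQT, hι, -, -, -, hcong, hφ, hφx', hx'x, hinert⟩ :=
    exists_fixedPoint_liftAction σ hx hGx hnf hπ
  haveI := hRloc
  haveI := hιloc
  -- the model `S` of `𝒪_{X,x}` in its fraction field is a regular local ring
  let O := X.presheaf.stalk x
  let f : O →+* FractionRing O := algebraMap O (FractionRing O)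
  have hf : Function.Injective f := IsFractionRing.injective O (FractionRing O)
  have hrr : Function.Injective f.rangeRestrict := fun a b h => hf (congrArg Subtype.val h)
  let e : O ≃+* f.range := RingEquiv.ofBijective f.rangeRestrict ⟨hrr, RingHom.rangeRestrict_surjective f⟩
  haveI : IsRegularLocalRing f.range := IsRegularLocalRing.of_ringEquiv e
  haveI : IsRegularLocalRing R := isRegularLocalRing_of_isQuadraticTransform _ R hQT
  obtain ⟨eR⟩ := nonempty_stalk_ringEquiv_of_isQuadraticTransform hx hπ R hQT ι hι φ hφ hφx'
  -- same residue field, in the two forms needed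
  have hsurj : ∀ z : R, ∃ s : O, z - ι s ∈ maximalIdeal R := fun z => by
    obtain ⟨a, ha⟩ := hcong z
    exact ⟨a, by rw [← neg_sub]; exact neg_mem ha⟩
  have hres : ∀ r : R, ∃ s : f.range, r - Subring.inclusion hQT.dominates.1 s ∈ maximalIdeal R := by
    intro r
    obtain ⟨a, ha⟩ := hsurj r
    refine ⟨e a, ?_⟩
    have : Subring.inclusion hQT.dominates.1 (e a) = ι a := Subtype.ext (by rw [hι]; rfl)
    rwa [this]
  haveI : IsAlgClosed (ResidueField R) := isAlgClosed_residueField_of_residue_surjective ι hsurj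
  -- dimension and closedness
  have hdimR : ringKrullDim R = ringKrullDim (X.presheaf.stalk x) := by
    rw [ringKrullDim_eq_of_isQuadraticTransform_of_residue _ R hQT hres]
    exact ringKrullDim_eq_of_ringEquiv e.symm
  have hdim : ringKrullDim (X'.presheaf.stalk x') = ringKrullDim (X.presheaf.stalk x) := by
    rw [ringKrullDim_eq_of_ringEquiv eR, hdimR]
  have hclosed : IsClosed ({x'} : Set X') := by
    refine hπ.isClosed_singleton_of_ringKrullDim_eq (x' := x') (by rw [hx'x]; exact hx) ?_
    rw [hdim, hx'x]
  exact ⟨x', hx'x, hclosed, hinert, IsRegularLocalRing.of_ringEquiv eR.symm,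
    IsAlgClosed.of_ringEquiv (ResidueField R) _ (ResidueField.mapEquiv eR.symm), hdim⟩

/-! ## The step reproduces its own hypotheses -/

/-- A regular local ring is a field iff its dimension is `0`; hence regular local rings of equal dimension are
simultaneously fields or not. [folklore] -/
theorem not_isField_of_ringKrullDim_eq {A B : Type*} [CommRing A] [CommRing B] [IsRegularLocalRing A]
    [IsRegularLocalRing B] (h : ringKrullDim B = ringKrullDim A) (hA : ¬ IsField A) : ¬ IsField B := by
  intro hB
  apply hA
  rw [IsLocalRing.isField_iff_maximalIdeal_eq] at hB ⊢
  rw [← Submodule.spanFinrank_eq_zero_iff_eq_bot (IsNoetherian.noetherian _)] at hB ⊢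
  have hA' := IsRegularLocalRing.spanFinrank_maximalIdeal (R := A)
  have hB' := IsRegularLocalRing.spanFinrank_maximalIdeal (R := B)
  rw [hB, h] at hB'
  rw [← hB'] at hA'
  exact_mod_cast hA'

/-- **The Kollár–Szabó point blow-up step reproduces all of its hypotheses**: in the situation of
✓`exists_closed_regular_fixedPoint_liftAction`, the blown-up scheme `X'` is again integral and locally
Noetherian, and at the fixed point `x'` — closed, in the inertia of every `g` for the lifted action — the
local ring is regular, NOT a field, of the same dimension, with algebraically closed residue field. So the
construction iterates along any tower of point blow-ups at the successive fixed points.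
[cite: ReichsteinYoussin2000, Appendix (Kollár–Szabó), proof of Prop. A.2] -/
theorem exists_fixedPoint_liftAction_step {X : Scheme.{0}} [IsIntegral X] [IsLocallyNoetherian X]
    {G : Type} [CommGroup G] (σ : G →* Aut X) {x : X} (hx : IsClosed ({x} : Set X))
    (hGx : ∀ g, g ∈ inertiaSubgroup σ x)
    [IsRegularLocalRing (X.presheaf.stalk x)] [IsAlgClosed (ResidueField (X.presheaf.stalk x))]
    (hnf : ¬ IsField (X.presheaf.stalk x))
    {X' : Scheme.{0}} {π : X' ⟶ X} (hπ : IsBlowup π (vanishingIdeal ⟨{x}, hx⟩)) :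
    IsIntegral X' ∧ IsLocallyNoetherian X' ∧
    ∃ x' : X', π x' = x ∧ IsClosed ({x'} : Set X') ∧
      (∀ g, g ∈ inertiaSubgroup (hπ.liftAction σ (vanishingIdeal_comap_eq_of_action σ ⟨{x}, hx⟩
        (preimage_singleton_eq_of_forall_mem_inertiaSubgroup σ hGx))) x') ∧
      IsRegularLocalRing (X'.presheaf.stalk x') ∧ IsAlgClosed (ResidueField (X'.presheaf.stalk x')) ∧
      ¬ IsField (X'.presheaf.stalk x') ∧
      ringKrullDim (X'.presheaf.stalk x') = ringKrullDim (X.presheaf.stalk x) := by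
  have hint : IsIntegral X' :=
    hπ.isIntegral (vanishingIdeal_singleton_ne_bot hx (genericPoint_ne_of_not_isField hnf))
  obtain ⟨x', hx'x, hcl, hinert, hreg, halg, hdim⟩ :=
    exists_closed_regular_fixedPoint_liftAction σ hx hGx hnf hπ
  haveI := hreg
  exact ⟨hint, hπ.isLocallyNoetherian, x', hx'x, hcl, hinert, hreg, halg,
    not_isField_of_ringKrullDim_eq hdim hnf, hdim⟩

end Summit.ResolutionOfSingularities.ResolutionOfSingularities.Theorems.WildQuotientResolution.KSGoingDown

end
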